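import Mathlib.NumberTheory.ArithmeticFunction.Misc
import Mathlib.NumberTheory.Harmonic.Bounds
import Mathlib.Data.Nat.Factorization.Basic
import HarnessLib

/-!
# The divisor function on a short interval — an elementary bound

Trunk AntSieve, tooling toward the named fact `Literature.NumberTheory.Sieve.weakDHL_three_two_of_GEH`
(D. H. J. Polymath, Res. Math. Sci. 1:12 (2014) = arXiv:1407.4897, Theorem 3.2(xii)).  In the
deduction of `EH[ϑ]` from `GEH[ϑ]` (Proposition 2.7, "Vaughan's identity and dyadic decomposition",
p. 7) the dyadic (here `ρ`-adic, `ρ = 1 + (log x)^{-B}`) pieces of the Type II sum whose product range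
straddles `x` are estimated trivially; what is needed is that few integers with many divisors lie in
the short range `(x/ρ², ρ² x]`:

* `sigma_zero_le_two_mul_card_small_divisors` — `τ(n) ≤ 2 #{d ∣ n : d² ≤ n}`;
* `sum_Ioc_sigma_zero_le` — `Σ_{y₁ < n ≤ y₂} τ(n) ≤ 2 (y₂ − y₁)(1 + log y₂) + 2 √y₂`
  (swap the sums: `Σ_{d ≤ √y₂} #{multiples of d in (y₁, y₂]} ≤ Σ_{d ≤ √y₂} ((y₂ − y₁)/d + 1)`).

## References

* [Polymath8b2014] D. H. J. Polymath, Res. Math. Sci. 1 (2014), Art. 12 = arXiv:1407.4897,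
  Proposition 2.7 (p. 7).
-/

open Finset Real
open scoped ArithmeticFunction.sigma

namespace Literature.NumberTheory.Sieve

/-- `τ(n) ≤ 2 #{d ∣ n : d·d ≤ n}`: `d ↦ n/d` maps the large divisors injectively into the small ones.
[folklore] -/
theorem sigma_zero_le_two_mul_card_small_divisors (n : ℕ) :
    σ 0 n ≤ 2 * #(n.divisors.filter fun d => d * d ≤ n) := by
  rw [ArithmeticFunction.sigma_zero_apply]
  set A := n.divisors.filter fun d => d * d ≤ n with hA
  set B := n.divisors.filter fun d => ¬ d * d ≤ n with hB
  have hsplit : #n.divisors = #A + #B := by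
    rw [hA, hB, Finset.card_filter_add_card_filter_not]
  have hBA : #B ≤ #A := by
    refine Finset.card_le_card_of_injOn (fun d => n / d) ?_ ?_
    · intro d hd
      rw [Finset.mem_coe, hB, Finset.mem_filter, Nat.mem_divisors] at hd
      obtain ⟨⟨hdn, hn⟩, hdd⟩ := hd
      rw [not_le] at hdd
      have hd0 : 0 < d := Nat.pos_of_dvd_of_pos hdn (Nat.pos_of_ne_zero hn)
      rw [Finset.mem_coe, hA, Finset.mem_filter, Nat.mem_divisors]
      refine ⟨⟨Nat.div_dvd_of_dvd hdn, hn⟩, ?_⟩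
      have h1 : n / d * d = n := Nat.div_mul_cancel hdn
      have h2 : n / d < d := by
        by_contra h
        rw [not_lt] at h
        have : d * d ≤ n / d * d := Nat.mul_le_mul_right d h
        omega
      calc n / d * (n / d) ≤ n / d * d := Nat.mul_le_mul_left _ h2.le
        _ = n := h1
    · intro d hd d' hd' h
      rw [Finset.mem_coe, hB, Finset.mem_filter, Nat.mem_divisors] at hd hd'
      have h1 : n / d * d = n := Nat.div_mul_cancel hd.1.1
      have h2 : n / d' * d' = n := Nat.div_mul_cancel hd'.1.1
      have hq0 : 0 < n / d := by
        rcases Nat.eq_zero_or_pos (n / d) with h0 | h0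
        · rw [h0, zero_mul] at h1; exact absurd h1.symm hd.1.2
        · exact h0
      simp only at h
      rw [h] at h1 hq0
      exact Nat.eq_of_mul_eq_mul_left hq0 (h1.trans h2.symm)
  omega

/-- Multiples of `d` in `(y₁, y₂]`: `#{n ∈ (y₁, y₂] : d ∣ n} = y₂/d − y₁/d`. [folklore] -/
theorem card_Ioc_filter_dvd (d y₁ y₂ : ℕ) (h : y₁ ≤ y₂) :
    #((Ioc y₁ y₂).filter fun n => d ∣ n) = y₂ / d - y₁ / d := by
  have hsplit : (Ioc 0 y₂).filter (fun n => d ∣ n) =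
      (Ioc 0 y₁).filter (fun n => d ∣ n) ∪ (Ioc y₁ y₂).filter (fun n => d ∣ n) := by
    rw [← Finset.filter_union]
    congr 1
    ext n; simp only [Finset.mem_Ioc, Finset.mem_union]; omega
  have hdisj : Disjoint ((Ioc 0 y₁).filter (fun n => d ∣ n)) ((Ioc y₁ y₂).filter (fun n => d ∣ n)) := by
    rw [Finset.disjoint_left]
    intro n hn hn'
    have h1 := (Finset.mem_filter.1 hn).1
    have h2 := (Finset.mem_filter.1 hn').1
    rw [Finset.mem_Ioc] at h1 h2
    omega
  have hcard := Finset.card_union_of_disjoint hdisj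
  rw [← hsplit, Nat.Ioc_filter_dvd_card_eq_div, Nat.Ioc_filter_dvd_card_eq_div] at hcard
  omega

/-- **The divisor function on a short interval**: for naturals `y₁ ≤ y₂`,
`Σ_{y₁ < n ≤ y₂} τ(n) ≤ 2 (y₂ − y₁)(1 + log y₂) + 2 √y₂`. [folklore] -/
theorem sum_Ioc_sigma_zero_le {y₁ y₂ : ℕ} (h : y₁ ≤ y₂) :
    ∑ n ∈ Ioc y₁ y₂, (σ 0 n : ℝ) ≤ 2 * ((y₂ - y₁ : ℝ) * (1 + Real.log y₂)) + 2 * Real.sqrt y₂ := by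
  set s := Nat.sqrt y₂ with hs
  -- Step 1: `τ(n) ≤ 2 #{d ≤ s : d ∣ n}` for `n ≤ y₂`
  have step1 : ∀ n ∈ Ioc y₁ y₂, (σ 0 n : ℝ) ≤ 2 * #((Icc 1 s).filter fun d => d ∣ n) := by
    intro n hn
    rw [Finset.mem_Ioc] at hn
    have h1 := sigma_zero_le_two_mul_card_small_divisors n
    have h2 : #(n.divisors.filter fun d => d * d ≤ n) ≤ #((Icc 1 s).filter fun d => d ∣ n) := by
      refine Finset.card_le_card fun d hd => ?_
      rw [Finset.mem_filter, Nat.mem_divisors] at hd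
      rw [Finset.mem_filter, Finset.mem_Icc]
      refine ⟨⟨Nat.pos_of_dvd_of_pos hd.1.1 (by omega), ?_⟩, hd.1.1⟩
      rw [hs, Nat.le_sqrt]
      exact hd.2.trans hn.2
    exact_mod_cast h1.trans (Nat.mul_le_mul_left 2 h2)
  -- Step 2: swap the sums
  have step2 : ∑ n ∈ Ioc y₁ y₂, (#((Icc 1 s).filter fun d => d ∣ n) : ℝ) =
      ∑ d ∈ Icc 1 s, (#((Ioc y₁ y₂).filter fun n => d ∣ n) : ℝ) := by
    simp only [Finset.card_eq_sum_ones, Nat.cast_sum, Finset.sum_filter]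
    push_cast
    exact Finset.sum_comm
  -- Step 3: count multiples
  have step3 : ∀ d ∈ Icc 1 s, (#((Ioc y₁ y₂).filter fun n => d ∣ n) : ℝ) ≤ (y₂ - y₁ : ℝ) / d + 1 := by
    intro d hd
    rw [Finset.mem_Icc] at hd
    rw [card_Ioc_filter_dvd d y₁ y₂ h]
    have hd0 : (0 : ℝ) < d := by exact_mod_cast hd.1
    have e1 : ((y₂ / d - y₁ / d : ℕ) : ℝ) = (y₂ / d : ℕ) - (y₁ / d : ℕ) := by
      rw [Nat.cast_sub (Nat.div_le_div_right h)]
    rw [e1]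
    have h1 : ((y₂ / d : ℕ) : ℝ) ≤ (y₂ : ℝ) / d := Nat.cast_div_le
    have h2 : (y₁ : ℝ) / d - 1 ≤ ((y₁ / d : ℕ) : ℝ) := by
      have := Nat.lt_div_mul_add (a := y₁) hd.1
      have h3 : (y₁ : ℝ) < ((y₁ / d : ℕ) : ℝ) * d + d := by exact_mod_cast this
      rw [div_sub_one (ne_of_gt hd0), div_le_iff₀ hd0]
      linarith
    rw [sub_div]
    linarith
  -- combine
  calc ∑ n ∈ Ioc y₁ y₂, (σ 0 n : ℝ) ≤ ∑ n ∈ Ioc y₁ y₂, (2 * #((Icc 1 s).filter fun d => d ∣ n) : ℝ) :=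
        Finset.sum_le_sum step1
    _ = 2 * ∑ d ∈ Icc 1 s, (#((Ioc y₁ y₂).filter fun n => d ∣ n) : ℝ) := by
        rw [← Finset.mul_sum, step2]
    _ ≤ 2 * ∑ d ∈ Icc 1 s, ((y₂ - y₁ : ℝ) / d + 1) :=
        mul_le_mul_of_nonneg_left (Finset.sum_le_sum step3) (by norm_num)
    _ = 2 * ((y₂ - y₁ : ℝ) * ∑ d ∈ Icc 1 s, (1 : ℝ) / d) + 2 * s := by
        rw [Finset.sum_add_distrib, Finset.sum_const, Nat.card_Icc, nsmul_eq_mul, Finset.mul_sum,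
          add_tsub_cancel_right, mul_one, mul_add]
        congr 2
        refine Finset.sum_congr rfl fun d _ => ?_
        ring
    _ ≤ 2 * ((y₂ - y₁ : ℝ) * (1 + Real.log y₂)) + 2 * Real.sqrt y₂ := by
        have hH : ∑ d ∈ Icc 1 s, (1 : ℝ) / d ≤ 1 + Real.log y₂ := by
          rcases Nat.eq_zero_or_pos s with h0 | hs0
          · rw [h0, Finset.Icc_eq_empty_of_lt Nat.one_pos, Finset.sum_empty]
            linarith [Real.log_natCast_nonneg y₂]
          · have h1 : ∑ d ∈ Icc 1 s, (1 : ℝ) / d = harmonic s := by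
              rw [harmonic_eq_sum_Icc]
              push_cast
              refine Finset.sum_congr rfl fun d _ => ?_
              rw [one_div]
            rw [h1]
            refine (harmonic_le_one_add_log s).trans ?_
            have : Real.log s ≤ Real.log y₂ := by
              refine Real.log_le_log (by exact_mod_cast hs0) ?_
              exact_mod_cast (Nat.sqrt_le_self y₂)
            linarith
        have hsq : (s : ℝ) ≤ Real.sqrt y₂ := by
          rw [hs, Real.le_sqrt (by positivity) (by positivity)]
          exact_mod_cast Nat.sqrt_le' y₂
        have hy : 0 ≤ (y₂ - y₁ : ℝ) := by
          have : (y₁ : ℝ) ≤ y₂ := by exact_mod_cast h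
          linarith
        nlinarith [mul_le_mul_of_nonneg_left hH hy]

end Literature.NumberTheory.Sieve
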